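import Summits.QuantumFields.YangMills.Theorems.LangevinControlUVFemtoCurvatureTwoPointCDefsCore
import Summits.QuantumFields.YangMills.Theorems.LangevinControlUVFemtoCurvatureTwoPointCStubTwoLoopAdmissible
import Summits.QuantumFields.YangMills.Theorems.LangevinControlUVFemtoCurvatureTwoPointCStubTwoLoopStepLaw
import Summits.QuantumFields.YangMills.Theorems.LangevinControlUVFemtoCurvatureTwoPointCTwoLoopBareSize

/-!
# Route `LangevinControlUV`, crux `FemtoCurvatureTwoPointC` (stmt-QuantumFields-16204), line `birth` — the running bridge
# `intrinsicRunning_of_diagonalScaling`: stub R reduces to DIAGONAL two-sided matching of the explicit two-loop coupling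

Line `birth` cuts the femto-engine statement `AFProfilesCoreAt r` into the stubs R (an admissible asymptotic-freedom box
coupling `u` with diagonal two-sided matching), D, LU, V. This file discharges the existential of R by the EXPLICIT two-loop
coupling `u = twoLoopCoupling κ c₀ b₀ q` (`…CDefs`: `u L β = (twoLoopPsi q (twoLoopT κ c₀ b₀ q L β))⁻¹`, definitionally the
`u` written out in the hypothesis), whose calculus is landed:

* positivity everywhere, continuity of `u L`, freezing `u L β → 0` (`β → +∞`): `stub_twoLoopAdmissible`
  (`…CStubTwoLoopAdmissible`);
* in-window comparability and the two-sided dyadic step law (`κ₁ = 2 b₀ log 2`, `κ₃ = 0`): `stub_twoLoopStepLaw`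
  (`…CStubTwoLoopStepLaw`), the window hypotheses being used only at the top box `L`, resp. at `M = 8 · 2^(k+m)`;
* the bare size `c₈ ≤ β · u(8, β)` for `β ≥ β₈`: `twoLoopCoupling_bareSize` (`…CTwoLoopBareSize`).

Hence R follows from the single remaining clause, the two diagonal inequalities
`c · u(L,β)² ≤ ⌊L/8⌋⁸ · Cov_{L,β}(P₀^{01}, P_{⌊L/8⌋e₂}^{01}) ≤ C · u(L,β)²` for this explicit `u` (threshold raised to
`max β₀ β₈`). The assembly is, almost verbatim, `afProfilesCoreAt_of_asymptoticScalingCoreAt` of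
`…CScalingCoreReduction` (four matching clauses there, one here). Nothing is asserted; no `sorry`.
-/

set_option autoImplicit false

noncomputable section

open Filter Topology MeasureTheory
open Literature.MathematicalPhysics.QuantumFieldTheory

namespace Summit.QuantumFields.YangMills.Theorems.FemtoCurvatureTwoPointC

/-- **Running bridge of line `birth` (registered sub-goal `intrinsicRunning_of_diagonalScaling`)**: if the explicit two-loop
coupling `u = twoLoopCoupling κ c₀ b₀ q` (`κ > 0`, `b₀ > 0`, `q ≥ 0`, window height `u₀` with `u₀ · ψ_q(2 b₀ log 2) < 1`)
satisfies DIAGONAL two-sided matching `c · u(L,β)² ≤ ⌊L/8⌋⁸ · Cov_{L,β}(P₀^{01}, P_{⌊L/8⌋e₂}^{01}) ≤ C · u(L,β)²` on every box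
`L ≥ 8` in the `u`-window at `β ≥ β₀`, then it is an admissible asymptotic-freedom box coupling with that same diagonal
matching: positive, continuous on `[β₀, ∞)`, freezing, of bare size `c₈ / β` on the smallest box, in-window comparable, with the
two-sided dyadic step law (`κ₃ = 0`; threshold raised to `max β₀ β₈`, `β₈` the bare-size threshold). -/
theorem intrinsicRunning_of_diagonalScaling :
    ∀ {G : Type} [Group G] [TopologicalSpace G] [IsTopologicalGroup G] [CompactSpace G]
        [MeasurableSpace G] [BorelSpace G] (r : LatticeRep G),
      (∃ (κ c₀ b₀ q u₀ β₀ c C : ℝ),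
        0 < κ ∧ 0 < b₀ ∧ 0 ≤ q ∧ 0 < u₀ ∧
        u₀ * (1 + 2 * b₀ * Real.log 2 + q * Real.log (2 * b₀ * Real.log 2 + Real.exp 1)) < 1 ∧ 0 < c ∧
        ∀ (T u : ℕ → ℝ → ℝ),
          (T = fun (L : ℕ) (β : ℝ) => max (κ * β + c₀) 1 - q * Real.log (max (κ * β + c₀) 1 + q) -
              2 * b₀ * Real.log ((L : ℝ) / 8)) →
          (u = fun (L : ℕ) (β : ℝ) => ((1 + q) * Real.exp (min (T L β) 0) + max (T L β) 0 +
              q * (Real.log (max (T L β) 0 + Real.exp 1) - 1))⁻¹) →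
          ∀ (L : ℕ) [NeZero L] (β : ℝ), β₀ ≤ β → 8 ≤ L →
            (∀ M : ℕ, 8 ≤ M → M ≤ L → u M β ≤ u₀) →
            ∀ (P : (Fin 4 → ZMod L) → Fin 4 → Fin 4 → GaugeConfig 4 L G → ℝ)
              (E : (GaugeConfig 4 L G → ℝ) → ℝ),
              (P = fun x i j U => (r.N : ℝ) - (r.ρ (plaquetteHolonomy U x i j)).trace.re) →
              (E = fun F => wilsonExpectation r.ρ β F) →
              c * u L β ^ 2 ≤
                ((L / 8 : ℕ) : ℝ) ^ 8 * (E (fun U => P 0 0 1 U * P (Pi.single (2 : Fin 4) ((L / 8 : ℕ) : ZMod L)) 0 1 U)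
                  - E (P 0 0 1) * E (P (Pi.single (2 : Fin 4) ((L / 8 : ℕ) : ZMod L)) 0 1)) ∧
              ((L / 8 : ℕ) : ℝ) ^ 8 * (E (fun U => P 0 0 1 U * P (Pi.single (2 : Fin 4) ((L / 8 : ℕ) : ZMod L)) 0 1 U)
                  - E (P 0 0 1) * E (P (Pi.single (2 : Fin 4) ((L / 8 : ℕ) : ZMod L)) 0 1)) ≤ C * u L β ^ 2) →
      ∃ (u : ℕ → ℝ → ℝ) (u₀ β₀ κ₁ κ₂ κ₃ c C c₈ : ℝ),
      0 < u₀ ∧ 0 < c ∧ 0 < κ₁ ∧ 0 ≤ κ₃ ∧ 0 < c₈ ∧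
      (∀ (L : ℕ) (β : ℝ), 8 ≤ L → β₀ ≤ β → 0 < u L β) ∧
      (∀ L : ℕ, 8 ≤ L → ContinuousOn (u L) (Set.Ici β₀)) ∧
      (∀ L : ℕ, 8 ≤ L → Filter.Tendsto (u L) Filter.atTop (nhds 0)) ∧
      (∀ β : ℝ, β₀ ≤ β → c₈ ≤ β * u 8 β) ∧
      (∀ (L L' : ℕ) (β : ℝ), β₀ ≤ β → 8 ≤ L → L ≤ L' → L' ≤ 2 * L →
          (∀ M : ℕ, 8 ≤ M → M ≤ L → u M β ≤ u₀) → |(u L β)⁻¹ - (u L' β)⁻¹| ≤ κ₂) ∧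
      (∀ (k m : ℕ) (β : ℝ), β₀ ≤ β → (∀ M : ℕ, 8 ≤ M → M ≤ 8 * 2 ^ (k + m) → u M β ≤ u₀) →
          κ₁ * m - κ₃ ≤ (u (8 * 2 ^ k) β)⁻¹ - (u (8 * 2 ^ (k + m)) β)⁻¹ ∧
            (u (8 * 2 ^ k) β)⁻¹ - (u (8 * 2 ^ (k + m)) β)⁻¹ ≤ κ₂ * m + κ₃) ∧
      (∀ (L : ℕ) [NeZero L] (β : ℝ), β₀ ≤ β → 8 ≤ L →
          (∀ M : ℕ, 8 ≤ M → M ≤ L → u M β ≤ u₀) →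
          ∀ (P : (Fin 4 → ZMod L) → Fin 4 → Fin 4 → GaugeConfig 4 L G → ℝ)
            (E : (GaugeConfig 4 L G → ℝ) → ℝ),
            (P = fun x i j U => (r.N : ℝ) - (r.ρ (plaquetteHolonomy U x i j)).trace.re) →
            (E = fun F => wilsonExpectation r.ρ β F) →
            c * u L β ^ 2 ≤
              ((L / 8 : ℕ) : ℝ) ^ 8 * (E (fun U => P 0 0 1 U * P (Pi.single (2 : Fin 4) ((L / 8 : ℕ) : ZMod L)) 0 1 U)
                - E (P 0 0 1) * E (P (Pi.single (2 : Fin 4) ((L / 8 : ℕ) : ZMod L)) 0 1)) ∧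
            ((L / 8 : ℕ) : ℝ) ^ 8 * (E (fun U => P 0 0 1 U * P (Pi.single (2 : Fin 4) ((L / 8 : ℕ) : ZMod L)) 0 1 U)
              - E (P 0 0 1) * E (P (Pi.single (2 : Fin 4) ((L / 8 : ℕ) : ZMod L)) 0 1)) ≤ C * u L β ^ 2) := by
  intro G _ _ _ _ _ _ r h
  obtain ⟨κ, c₀, b₀, q, u₀, β₀, c, C, hκ, hb₀, hq, hu₀, hu₀ψ, hc, hphys⟩ := h
  -- name the two-loop RG time `T` and the coupling `u = ψ_q(T)⁻¹` written out in the hypothesis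
  set T : ℕ → ℝ → ℝ := fun (L : ℕ) (β : ℝ) => max (κ * β + c₀) 1 - q * Real.log (max (κ * β + c₀) 1 + q) -
    2 * b₀ * Real.log ((L : ℝ) / 8) with hT
  set u : ℕ → ℝ → ℝ := fun (L : ℕ) (β : ℝ) => ((1 + q) * Real.exp (min (T L β) 0) + max (T L β) 0 +
    q * (Real.log (max (T L β) 0 + Real.exp 1) - 1))⁻¹ with hu
  -- the diagonal matching clause for this `u`, and the landed calculus of the explicit coupling
  have hdiag := hphys T u hT hu
  obtain ⟨hpos, hcont, hfrz⟩ := stub_twoLoopAdmissible κ c₀ b₀ q hκ hq T u hT hu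
  obtain ⟨κ₁, κ₂, hκ₁, hcomp, hstep⟩ := stub_twoLoopStepLaw κ c₀ b₀ q u₀ hb₀ hq hu₀ hu₀ψ T u hT hu
  obtain ⟨c₈, β₈, hc₈, hbare⟩ := twoLoopCoupling_bareSize κ c₀ b₀ q hκ hq
  -- the local `u` is the tree's `twoLoopCoupling`
  have hu_eq : ∀ (L : ℕ) (β : ℝ), twoLoopCoupling κ c₀ b₀ q L β = u L β := fun L β => rfl
  -- common threshold: the matching threshold `β₀` and the bare-size threshold `β₈`
  set β₁ : ℝ := max β₀ β₈ with hβ₁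
  have hβ₁₀ : β₀ ≤ β₁ := le_max_left _ _
  have hβ₁₈ : β₈ ≤ β₁ := le_max_right _ _
  refine ⟨u, u₀, β₁, κ₁, κ₂, 0, c, C, c₈, hu₀, hc, hκ₁, le_rfl, hc₈, fun L β _ _ => hpos L β,
    fun L _ => (hcont L).continuousOn, fun L _ => hfrz L, ?_, ?_, ?_, ?_⟩
  · -- bare size on the smallest box
    intro β hβ
    rw [← hu_eq]
    exact hbare β (hβ₁₈.trans hβ)
  · -- in-window comparability (window hypothesis used at the top box `L`)
    intro L L' β _ hL hLL' hL'L hwin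
    exact hcomp L L' β hL hLL' hL'L (hwin L hL le_rfl)
  · -- two-sided dyadic step law with slack `κ₃ = 0` (window hypothesis used at `M = 8 · 2^(k+m)`)
    intro k m β _ hwin
    have h8 : 8 ≤ 8 * 2 ^ (k + m) := Nat.le_mul_of_pos_right 8 (Nat.pow_pos (by norm_num))
    obtain ⟨h1, h2⟩ := hstep k m β (hwin (8 * 2 ^ (k + m)) h8 le_rfl)
    exact ⟨by linarith, by linarith⟩
  · -- the diagonal matching clause itself, at the raised threshold
    intro L _ β hβ hL hwin P E hP hE
    exact hdiag L β (hβ₁₀.trans hβ) hL hwin P E hP hE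

end Summit.QuantumFields.YangMills.Theorems.FemtoCurvatureTwoPointC

end
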